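import Literature.NumberTheory.Automorphic.ArchRankOneJumpZero               -- ★ p849935 (K0±)-U11 (this seat): the one-sided VALUES on `U(diag(1,−1))`
import Literature.NumberTheory.Automorphic.ArchEndoscopicTorusCayleyFrame      -- ★ B-p12: `det_cayleyTwo_ne_zero`, `coe_inv_cayleyTwo`, `formCongr_cayleyTwo`, `cayley_conj_circleDiagonal_mem_archLocal`
import Literature.NumberTheory.Automorphic.UnitaryGroupFormTransport           -- ★ `unitaryGroupOfFormCongrOfEq` (conjugation `g ↦ T g T⁻¹` along a form congruence)
import HarnessLib

/-!
# The one-sided values at the central wall IN THE CAYLEY FRAME: `2 sin ψ · ∫_{U(Φ₂)_w} f(h·(P diag(z e^{iψ}, z e^{−iψ}) P⁻¹)·h⁻¹) dν → C₁ • ∫ f(P·(half-cone)·P⁻¹)`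
# (Varadarajan 1989 §6.4 Lemma 21 (c), Thm 23; Rogawski 1990 §8.2 pp. 119, 122; Shelstad 1979 Lemma 4.3)

Topic `NumberTheory/Automorphic`; namespace `Literature.NumberTheory.Automorphic.UnitaryGroup`.  THEOREMS ONLY (no `def`, no instance, no notation, no axiom, no named fact, no
`sorry`).  Cell `pub/hodgecm-mathlib`, line LH3 (closer stub `stub_N9`, crux H413 = `stmt-HodgeConjecture-24833`), DIRECT ROAD brick **(K0±)-U11-CAYLEY** (LH10-p02 (g3) 2026-09-02,
sequel (b) to ★ p849935): the `w`-local input of organ (J-H) «ORDER-0 (I₃) for the stable families of `H_∞`» read on the TREE'S frame — the compact chart of `H_∞` at a place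
`w ∉ S` is the Cayley torus `P·diag(e^{iθ₀}, e^{iθ₂})·P⁻¹` of `U(Φ₂)_w = archLocal L 2 Φ₂ w`, `Φ₂ = antidiag(1,1)`, `P = (1 1; 1 −1)` (★ `endoBlock` of the (T-ATLAS) chart,
★ `cayley_conj_circleDiagonal_mem_archLocal`), and along the normal curve `(θ₀ + ν, θ₀ − ν)` of the noncompact wall `θ₀ = θ₂` this is `P·diag(z e^{iν}, z e^{−iν})·P⁻¹`, `z = e^{iθ₀}`.

THE MATHEMATICS.  `P̄ᵀ (σ_w Φ₂) P = diag(2,−2)` (★ `formCongr_cayleyTwo`), so `h′ ↦ P h′ P⁻¹` is a topological-group isomorphism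
`e : U(diag(2,−2)) = U(diag(1,−1)) ≃ₜ* U(Φ₂)_w` (★ `unitaryGroupOfFormCongrOfEq`; `U(2J) = U(J)`).  §1 TRANSPORT (no commuting hypothesis — the torus point moves with the frame,
unlike ★ (R1G) §2): for `e : S′ ≃ₜ* S`, `e h′ = T h′ T⁻¹`, any measure `ν` on `S`, any `f` and any `γ′ ∈ S′`,
`∫_S f(h · e(γ′) · h⁻¹) dν(h) = ∫_{S′} f(T (h′ γ′ h′⁻¹) T⁻¹) d(ν.map e⁻¹)(h′)` (`integral_map_equiv`; `e` is multiplicative).  §2 THE HEAD: pull a Haar measure `ν` on `U(Φ₂)_w` back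
to `μ′ = ν.map e⁻¹` (Haar on `U(diag(2,−2)) = U(diag(1,−1))`), replace `f` by `X ↦ f(P X P⁻¹)` (continuous, compact support: `Ad(P)` is a homeomorphism of `M₂(ℂ)`), and read ★
(K0±)-U11 `exists_tendsto_two_sin_smul_orbitalIntegral_nhdsGT_nhdsLT`: for every Haar `ν` on `U(Φ₂)_w` ONE `C₁ > 0` with, for every continuous compactly supported `f` and
`z ∈ S¹`, `2 sin ψ · ∫_{U(Φ₂)_w} f(h·(P diag(z e^{iψ}, z e^{−iψ}) P⁻¹)·h⁻¹) dν(h) → C₁ • ∫_{τ>0,θ} f(P (z·1 + τ·diag(iz,−iz) + τ·W_i θ) P⁻¹)` as `ψ → 0⁺` and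
`→ −C₁ • ∫ f(P (z·1 + τ·diag(−iz, iz) + τ·W_{−i} θ) P⁻¹)` as `ψ → 0⁻` — the two half-cone integrals of ★ p849935 pushed by `Ad(P)` (left un-multiplied: the (A0)-side pen picks
the cone parametrisation, (A0-c) matches); `HasOneSidedJump` corollary with jump `C₁ · ∫ f(P·(full cone)·P⁻¹)`.
HONEST LABEL: HC_CM is proved only modulo the 7 printed citations (2 remaining: hLiu418 = stmt-HodgeConjecture-24832, h413 = stmt-HodgeConjecture-24833) until rung 0 closes;
frame bookkeeping over ★ p849935, count-neutral, pays nothing by itself.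

WHAT IS PROVED.  §1 `unitaryGroupOfForm_diagonal_two_neg_two_eq` (`U(diag(2,−2)) = U(diag(1,−1))`), private `continuous_hasCompactSupport_comp_conj` (`X ↦ f(A X B)`),
**`integral_comp_conj_transport`** (the transport identity).  §2 **`exists_tendsto_two_sin_smul_orbitalIntegral_cayley_nhdsGT_nhdsLT (L) (w) (ν)`**,
**`exists_hasOneSidedJump_two_sin_mul_orbitalIntegral_cayley (L) (w) (ν)`** (`E = ℂ`).

## References
* [Varadarajan1989] V. S. Varadarajan, *An Introduction to Harmonic Analysis on Semisimple Lie Groups*, Cambridge Stud. Adv. Math. 16 (1989), §6.4 Lemma 21 (c), Thm 23.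
* [Rogawski1990] J. D. Rogawski, *Automorphic Representations of Unitary Groups in Three Variables*, Ann. of Math. Stud. 123 (1990), §8.2 pp. 119, 122–123 (the Cayley frame `g(ψ)`,
  `z·(cos ψ  i sin ψ; i sin ψ  cos ψ)`), §3.6 p. 31.
* [Shelstad1979] D. Shelstad, *Characters and inner forms of a quasi-split group over ℝ*, Compositio Math. 39 (1979), Lemma 4.3 p. 25.
* [PlatonovRapinchuk1994] V. Platonov, A. Rapinchuk, *Algebraic Groups and Number Theory* (1994), §2.3 (change of frame for unitary groups).
-/

set_option autoImplicit false

noncomputable section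

namespace Literature.NumberTheory.Automorphic.UnitaryGroup

open _root_.MeasureTheory Set Filter _root_.Topology _root_.Complex _root_.NumberField _root_.NumberField.InfinitePlace
open Literature.NumberTheory.Automorphic.Shelstad1979.StableOrbitalIntegrals
open scoped Real MatrixGroups

variable {E : Type*} [NormedAddCommGroup E] [NormedSpace ℝ E]

/-! ## §1 Frame bookkeeping -/

/-- `U(diag(2,−2)) = U(diag(1,−1))` (a non-zero scalar does not change the unitary group of a form). [cite: PlatonovRapinchuk1994, §2.3] -/
theorem unitaryGroupOfForm_diagonal_two_neg_two_eq :
    unitaryGroupOfForm (starRingEnd ℂ) (Matrix.diagonal ![(2 : ℂ), -2]) = unitaryGroupOfForm (starRingEnd ℂ) (Matrix.diagonal ![(1 : ℂ), -1]) := by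
  have h2 : Matrix.diagonal ![(2 : ℂ), -2] = (2 : ℂ) • Matrix.diagonal ![(1 : ℂ), -1] := by
    ext i j; fin_cases i <;> fin_cases j <;> simp
  ext g
  rw [mem_unitaryGroupOfForm_iff, mem_unitaryGroupOfForm_iff, h2, Matrix.mul_smul, Matrix.smul_mul]
  exact smul_right_inj (two_ne_zero)

omit [NormedSpace ℝ E] in
/-- `X ↦ f(A X B)` with `AB = 1 = BA` is continuous with compact support when `f` is (`Ad` is a homeomorphism of `M₂(ℂ)`). [folklore] -/
private theorem continuous_hasCompactSupport_comp_conj (A B : Matrix (Fin 2) (Fin 2) ℂ) (hAB : A * B = 1) (hBA : B * A = 1)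
    {f : Matrix (Fin 2) (Fin 2) ℂ → E} (hf : Continuous f) (hfc : HasCompactSupport f) :
    Continuous (fun X : Matrix (Fin 2) (Fin 2) ℂ => f (A * X * B)) ∧ HasCompactSupport (fun X : Matrix (Fin 2) (Fin 2) ℂ => f (A * X * B)) := by
  -- adapted from ★ (R1G) `ArchRankOneLimitFormulaGroup` (private `contDiff_hasCompactSupport_comp_conj`)
  refine ⟨hf.comp ((continuous_const.mul continuous_id).mul continuous_const), ?_⟩
  let φ : Matrix (Fin 2) (Fin 2) ℂ ≃ₜ Matrix (Fin 2) (Fin 2) ℂ :=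
    { toFun := fun X => A * X * B
      invFun := fun X => B * X * A
      left_inv := fun X => by
        show B * (A * X * B) * A = X
        rw [← Matrix.mul_assoc, ← Matrix.mul_assoc, hBA, Matrix.one_mul, Matrix.mul_assoc, hBA, Matrix.mul_one]
      right_inv := fun X => by
        show A * (B * X * A) * B = X
        rw [← Matrix.mul_assoc, ← Matrix.mul_assoc, hAB, Matrix.one_mul, Matrix.mul_assoc, hAB, Matrix.mul_one]
      continuous_toFun := (continuous_const.mul continuous_id).mul continuous_const
      continuous_invFun := (continuous_const.mul continuous_id).mul continuous_const }
  exact hfc.comp_homeomorph φ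

/-- **TRANSPORT OF AN ORBITAL INTEGRAL ALONG A CONJUGATION ISOMORPHISM, THE TORUS POINT MOVING WITH THE FRAME.**  Let `S′, S ≤ GL₂(ℂ)`, `e : S′ ≃ₜ* S` with
`e h′ = T h′ T⁻¹`.  For any measure `ν` on `S`, any `f : M₂(ℂ) → E` and any `γ′ ∈ S′`:
`∫_S f(h · e(γ′) · h⁻¹) dν(h) = ∫_{S′} f(T · (h′ γ′ h′⁻¹) · T⁻¹) d(ν.map e⁻¹)(h′)`.  (No commuting hypothesis, unlike ★ (R1G) §2: the torus point is transported too.)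
[cite: PlatonovRapinchuk1994, §2.3] [cite: Rogawski1990, §3.6 p. 31] -/
theorem integral_comp_conj_transport (S' S : Subgroup (GL (Fin 2) ℂ)) [MeasurableSpace S'] [BorelSpace S'] [MeasurableSpace S] [BorelSpace S]
    (e : S' ≃ₜ* S) (T : GL (Fin 2) ℂ) (he : ∀ h' : S', ((e h' : S) : GL (Fin 2) ℂ) = T * (h' : GL (Fin 2) ℂ) * T⁻¹)
    (ν : Measure S) (f : Matrix (Fin 2) (Fin 2) ℂ → E) (γ' : S') :
    ∫ h : S, f (((h * e γ' * h⁻¹ : S) : GL (Fin 2) ℂ) : Matrix (Fin 2) (Fin 2) ℂ) ∂ν =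
      ∫ h' : S', f ((T : Matrix (Fin 2) (Fin 2) ℂ) * (((h' * γ' * h'⁻¹ : S') : GL (Fin 2) ℂ) : Matrix (Fin 2) (Fin 2) ℂ) *
        ((T⁻¹ : GL (Fin 2) ℂ) : Matrix (Fin 2) (Fin 2) ℂ)) ∂(ν.map e.symm) := by
  rw [show (Measure.map (⇑e.symm) ν : Measure S') = Measure.map (⇑e.symm.toHomeomorph.toMeasurableEquiv) ν from rfl, integral_map_equiv]
  refine integral_congr_ae (Eventually.of_forall fun h => ?_)
  -- the measurable equivalence IS `e.symm`; restate through `e.symm h`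
  change f _ = f ((T : Matrix (Fin 2) (Fin 2) ℂ) * (((e.symm h * γ' * (e.symm h)⁻¹ : S') : GL (Fin 2) ℂ) : Matrix (Fin 2) (Fin 2) ℂ) *
    ((T⁻¹ : GL (Fin 2) ℂ) : Matrix (Fin 2) (Fin 2) ℂ))
  congr 1
  have hGL : ((h * e γ' * h⁻¹ : S) : GL (Fin 2) ℂ) = T * ((e.symm h * γ' * (e.symm h)⁻¹ : S') : GL (Fin 2) ℂ) * T⁻¹ := by
    rw [← he, map_mul, map_mul, map_inv, e.apply_symm_apply]
  rw [hGL, Units.val_mul, Units.val_mul]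

/-! ## §2 The one-sided values on `U(Φ₂)_w` in the Cayley frame -/

variable (L : Type) [Field L] (w : {w : InfinitePlace L // IsComplex w})

/-- The Cayley congruence `h′ ↦ P h′ P⁻¹ : U(diag(2,−2)) ≃ₜ* U(Φ₂)_w` (★ `unitaryGroupOfFormCongrOfEq` along ★ `formCongr_cayleyTwo`), with its value formula.
[cite: Rogawski1990, §8.2 p. 122] [cite: PlatonovRapinchuk1994, §2.3] -/
theorem exists_cayleyEquiv :
    ∃ e : ↥(unitaryGroupOfForm (starRingEnd ℂ) (Matrix.diagonal ![(2 : ℂ), -2])) ≃ₜ*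
        ↥(archLocal L 2 (Matrix.of fun i j : Fin 2 => if i.val + j.val + 1 = 2 then (1 : L) else 0) w),
      ∀ h' : ↥(unitaryGroupOfForm (starRingEnd ℂ) (Matrix.diagonal ![(2 : ℂ), -2])),
        ((e h' : ↥(archLocal L 2 (Matrix.of fun i j : Fin 2 => if i.val + j.val + 1 = 2 then (1 : L) else 0) w)) : GL (Fin 2) ℂ) =
          Matrix.GeneralLinearGroup.mkOfDetNeZero !![(1 : ℂ), 1; 1, -1] det_cayleyTwo_ne_zero * (h' : GL (Fin 2) ℂ) *
            (Matrix.GeneralLinearGroup.mkOfDetNeZero !![(1 : ℂ), 1; 1, -1] det_cayleyTwo_ne_zero)⁻¹ :=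
  ⟨unitaryGroupOfFormCongrOfEq (starRingEnd ℂ) (Matrix.GeneralLinearGroup.mkOfDetNeZero !![(1 : ℂ), 1; 1, -1] det_cayleyTwo_ne_zero) _ _
      (formCongr_cayleyTwo w.1.embedding), fun _ => rfl⟩

omit [Field L] in
/-- ★ (K0±)-U11 `exists_tendsto_two_sin_smul_orbitalIntegral_nhdsGT_nhdsLT` restated on any spelling `U(J)` of the standard group `U(diag(1,−1))` (used with `J = diag(2,−2)`).
[cite: Varadarajan1989, §6.4 Lemma 21 (c), Thm 23] -/
theorem tendsto_std_of_eq (J : Matrix (Fin 2) (Fin 2) ℂ)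
    (hJ : unitaryGroupOfForm (starRingEnd ℂ) J = unitaryGroupOfForm (starRingEnd ℂ) (Matrix.diagonal ![(1 : ℂ), -1])) :
    ∀ (hSJ : ∀ u : Fin 2 → Circle, circleDiagonal 2 u ∈ unitaryGroupOfForm (starRingEnd ℂ) J)
    [MeasurableSpace ↥(unitaryGroupOfForm (starRingEnd ℂ) J)] [BorelSpace ↥(unitaryGroupOfForm (starRingEnd ℂ) J)]
    (μ : Measure ↥(unitaryGroupOfForm (starRingEnd ℂ) J)) [μ.IsHaarMeasure],
    ∃ C₁ : ℝ, 0 < C₁ ∧ ∀ (f : Matrix (Fin 2) (Fin 2) ℂ → E), Continuous f → HasCompactSupport f → ∀ z : Circle,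
      Tendsto (fun ψ : ℝ => (2 * Real.sin ψ) •
          ∫ h : ↥(unitaryGroupOfForm (starRingEnd ℂ) J),
            f (((h * ⟨circleDiagonal 2 ![z * Circle.exp ψ, z * Circle.exp (-ψ)], hSJ _⟩ * h⁻¹ : ↥(unitaryGroupOfForm (starRingEnd ℂ) J)) :
              GL (Fin 2) ℂ) : Matrix (Fin 2) (Fin 2) ℂ) ∂μ)
        (𝓝[>] 0)
        (𝓝 (C₁ • ∫ p in Ioi (0 : ℝ) ×ˢ Ioc (0 : ℝ) (2 * π),
          f ((z : ℂ) • (1 : Matrix (Fin 2) (Fin 2) ℂ) + p.1 • Matrix.diagonal ![(z : ℂ) * I, -((z : ℂ) * I)] +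
            p.1 • !![(0 : ℂ), -((z : ℂ) * I) * cexp (-((p.2 : ℂ) * I)); ((z : ℂ) * I) * cexp ((p.2 : ℂ) * I), 0]))) ∧
      Tendsto (fun ψ : ℝ => (2 * Real.sin ψ) •
          ∫ h : ↥(unitaryGroupOfForm (starRingEnd ℂ) J),
            f (((h * ⟨circleDiagonal 2 ![z * Circle.exp ψ, z * Circle.exp (-ψ)], hSJ _⟩ * h⁻¹ : ↥(unitaryGroupOfForm (starRingEnd ℂ) J)) :
              GL (Fin 2) ℂ) : Matrix (Fin 2) (Fin 2) ℂ) ∂μ)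
        (𝓝[<] 0)
        (𝓝 (C₁ • -(∫ p in Ioi (0 : ℝ) ×ˢ Ioc (0 : ℝ) (2 * π),
          f ((z : ℂ) • (1 : Matrix (Fin 2) (Fin 2) ℂ) + p.1 • Matrix.diagonal ![-((z : ℂ) * I), (z : ℂ) * I] +
            p.1 • !![(0 : ℂ), ((z : ℂ) * I) * cexp (-((p.2 : ℂ) * I)); -((z : ℂ) * I) * cexp ((p.2 : ℂ) * I), 0])))) := by
  rw [hJ]
  intro hSJ _ _ μ _
  exact exists_tendsto_two_sin_smul_orbitalIntegral_nhdsGT_nhdsLT (E := E) μ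

/-- **(K0±)-U11 IN THE CAYLEY FRAME.**  For every Haar measure `ν` on `U(Φ₂)_w = archLocal L 2 Φ₂ w` there is ONE `C₁ > 0` such that for every continuous compactly supported
`f : M₂(ℂ) → E` and every `z ∈ S¹`, along the Cayley torus `P·diag(z e^{iψ}, z e^{−iψ})·P⁻¹` (= the (T-ATLAS) compact chart along the normal curve of the wall `θ₀ = θ₂`),
`2 sin ψ · ∫_{U(Φ₂)_w} f(h·(P diag(z e^{iψ}, z e^{−iψ}) P⁻¹)·h⁻¹) dν(h) → C₁ • ∫_{τ>0, θ∈(0,2π]} f(P·(z·1 + τ·diag(iz,−iz) + τ·(0, −iz e^{−iθ}; iz e^{iθ}, 0))·P⁻¹) dτ dθ` as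
`ψ → 0⁺`, and `→ C₁ • −∫ f(P·(z·1 + τ·diag(−iz,iz) + τ·(0, iz e^{−iθ}; −iz e^{iθ}, 0))·P⁻¹)` as `ψ → 0⁻` (★ p849935 transported along ★ `formCongr_cayleyTwo`; `P = (1 1; 1 −1)`).
[cite: Varadarajan1989, §6.4 Lemma 21 (c), Thm 23] [cite: Rogawski1990, §8.2 pp. 119, 122] -/
theorem exists_tendsto_two_sin_smul_orbitalIntegral_cayley_nhdsGT_nhdsLT
    [MeasurableSpace (archLocal L 2 (Matrix.of fun i j : Fin 2 => if i.val + j.val + 1 = 2 then (1 : L) else 0) w)]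
    [BorelSpace (archLocal L 2 (Matrix.of fun i j : Fin 2 => if i.val + j.val + 1 = 2 then (1 : L) else 0) w)]
    (ν : Measure (archLocal L 2 (Matrix.of fun i j : Fin 2 => if i.val + j.val + 1 = 2 then (1 : L) else 0) w)) [ν.IsHaarMeasure] :
    ∃ C₁ : ℝ, 0 < C₁ ∧
      ∀ (f : Matrix (Fin 2) (Fin 2) ℂ → E), Continuous f → HasCompactSupport f → ∀ z : Circle,
        Tendsto (fun ψ : ℝ => (2 * Real.sin ψ) •
            ∫ h : archLocal L 2 (Matrix.of fun i j : Fin 2 => if i.val + j.val + 1 = 2 then (1 : L) else 0) w,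
              f (((h * ⟨Matrix.GeneralLinearGroup.mkOfDetNeZero !![(1 : ℂ), 1; 1, -1] det_cayleyTwo_ne_zero *
                    circleDiagonal 2 ![z * Circle.exp ψ, z * Circle.exp (-ψ)] *
                    (Matrix.GeneralLinearGroup.mkOfDetNeZero !![(1 : ℂ), 1; 1, -1] det_cayleyTwo_ne_zero)⁻¹,
                  cayley_conj_circleDiagonal_mem_archLocal L w _⟩ * h⁻¹ :
                archLocal L 2 (Matrix.of fun i j : Fin 2 => if i.val + j.val + 1 = 2 then (1 : L) else 0) w) : GL (Fin 2) ℂ) : Matrix (Fin 2) (Fin 2) ℂ) ∂ν)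
          (𝓝[>] 0)
          (𝓝 (C₁ • ∫ p in Ioi (0 : ℝ) ×ˢ Ioc (0 : ℝ) (2 * π),
            f ((!![(1 : ℂ), 1; 1, -1] : Matrix (Fin 2) (Fin 2) ℂ) *
              ((z : ℂ) • (1 : Matrix (Fin 2) (Fin 2) ℂ) + p.1 • Matrix.diagonal ![(z : ℂ) * I, -((z : ℂ) * I)] +
                p.1 • !![(0 : ℂ), -((z : ℂ) * I) * cexp (-((p.2 : ℂ) * I)); ((z : ℂ) * I) * cexp ((p.2 : ℂ) * I), 0]) *
              !![(1 / 2 : ℂ), 1 / 2; 1 / 2, -(1 / 2)]))) ∧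
        Tendsto (fun ψ : ℝ => (2 * Real.sin ψ) •
            ∫ h : archLocal L 2 (Matrix.of fun i j : Fin 2 => if i.val + j.val + 1 = 2 then (1 : L) else 0) w,
              f (((h * ⟨Matrix.GeneralLinearGroup.mkOfDetNeZero !![(1 : ℂ), 1; 1, -1] det_cayleyTwo_ne_zero *
                    circleDiagonal 2 ![z * Circle.exp ψ, z * Circle.exp (-ψ)] *
                    (Matrix.GeneralLinearGroup.mkOfDetNeZero !![(1 : ℂ), 1; 1, -1] det_cayleyTwo_ne_zero)⁻¹,
                  cayley_conj_circleDiagonal_mem_archLocal L w _⟩ * h⁻¹ :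
                archLocal L 2 (Matrix.of fun i j : Fin 2 => if i.val + j.val + 1 = 2 then (1 : L) else 0) w) : GL (Fin 2) ℂ) : Matrix (Fin 2) (Fin 2) ℂ) ∂ν)
          (𝓝[<] 0)
          (𝓝 (C₁ • -(∫ p in Ioi (0 : ℝ) ×ˢ Ioc (0 : ℝ) (2 * π),
            f ((!![(1 : ℂ), 1; 1, -1] : Matrix (Fin 2) (Fin 2) ℂ) *
              ((z : ℂ) • (1 : Matrix (Fin 2) (Fin 2) ℂ) + p.1 • Matrix.diagonal ![-((z : ℂ) * I), (z : ℂ) * I] +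
                p.1 • !![(0 : ℂ), ((z : ℂ) * I) * cexp (-((p.2 : ℂ) * I)); -((z : ℂ) * I) * cexp ((p.2 : ℂ) * I), 0]) *
              !![(1 / 2 : ℂ), 1 / 2; 1 / 2, -(1 / 2)])))) := by
  -- the Cayley congruence `e : U(diag(2,−2)) ≃ₜ* U(Φ₂)_w`, `h′ ↦ P h′ P⁻¹` (opaque from here on)
  obtain ⟨e, he⟩ := exists_cayleyEquiv L w
  letI : MeasurableSpace ↥(unitaryGroupOfForm (starRingEnd ℂ) (Matrix.diagonal ![(2 : ℂ), -2])) := borel _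
  haveI : BorelSpace ↥(unitaryGroupOfForm (starRingEnd ℂ) (Matrix.diagonal ![(2 : ℂ), -2])) := ⟨rfl⟩
  -- the torus membership in `U(diag(2,−2))`
  have hS' : ∀ u : Fin 2 → Circle, circleDiagonal 2 u ∈ unitaryGroupOfForm (starRingEnd ℂ) (Matrix.diagonal ![(2 : ℂ), -2]) := fun u =>
    circleDiagonal_mem_unitaryGroupOfForm_diagonal 2 u _
  -- (K0±)-U11 on `U(diag(2,−2)) = U(diag(1,−1))` (★ p849935), at the pulled-back Haar measure `ν.map e⁻¹`
  obtain ⟨C₁, hC₁, hlim⟩ := tendsto_std_of_eq (E := E) _ unitaryGroupOfForm_diagonal_two_neg_two_eq hS' (ν.map e.symm)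
  refine ⟨C₁, hC₁, fun f hf hfc z => ?_⟩
  -- the transported test function `X ↦ f(P X P⁻¹)`
  have hPP : ((Matrix.GeneralLinearGroup.mkOfDetNeZero !![(1 : ℂ), 1; 1, -1] det_cayleyTwo_ne_zero : GL (Fin 2) ℂ) : Matrix (Fin 2) (Fin 2) ℂ) *
      (((Matrix.GeneralLinearGroup.mkOfDetNeZero !![(1 : ℂ), 1; 1, -1] det_cayleyTwo_ne_zero)⁻¹ : GL (Fin 2) ℂ) : Matrix (Fin 2) (Fin 2) ℂ) = 1 := by
    rw [← Units.val_mul, mul_inv_cancel, Units.val_one]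
  have hPP' : (((Matrix.GeneralLinearGroup.mkOfDetNeZero !![(1 : ℂ), 1; 1, -1] det_cayleyTwo_ne_zero)⁻¹ : GL (Fin 2) ℂ) : Matrix (Fin 2) (Fin 2) ℂ) *
      ((Matrix.GeneralLinearGroup.mkOfDetNeZero !![(1 : ℂ), 1; 1, -1] det_cayleyTwo_ne_zero : GL (Fin 2) ℂ) : Matrix (Fin 2) (Fin 2) ℂ) = 1 := by
    rw [← Units.val_mul, inv_mul_cancel, Units.val_one]
  obtain ⟨hfP, hfPc⟩ := continuous_hasCompactSupport_comp_conj (E := E) _ _ hPP hPP' hf hfc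
  obtain ⟨hGT, hLT⟩ := hlim _ hfP hfPc z
  rw [Matrix.GeneralLinearGroup.val_mkOfDetNeZero, coe_inv_cayleyTwo] at hGT hLT
  -- the torus point moves with the frame: `⟨P γ P⁻¹, _⟩ = e ⟨γ, _⟩`
  have hγ : ∀ ψ : ℝ, (⟨Matrix.GeneralLinearGroup.mkOfDetNeZero !![(1 : ℂ), 1; 1, -1] det_cayleyTwo_ne_zero *
        circleDiagonal 2 ![z * Circle.exp ψ, z * Circle.exp (-ψ)] * (Matrix.GeneralLinearGroup.mkOfDetNeZero !![(1 : ℂ), 1; 1, -1] det_cayleyTwo_ne_zero)⁻¹,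
        cayley_conj_circleDiagonal_mem_archLocal L w _⟩ :
      archLocal L 2 (Matrix.of fun i j : Fin 2 => if i.val + j.val + 1 = 2 then (1 : L) else 0) w) =
      e ⟨circleDiagonal 2 ![z * Circle.exp ψ, z * Circle.exp (-ψ)], hS' _⟩ := fun ψ =>
    Subtype.ext (he ⟨circleDiagonal 2 ![z * Circle.exp ψ, z * Circle.exp (-ψ)], hS' _⟩).symm
  -- the two functions of `ψ` agree
  have key : ∀ ψ : ℝ, (2 * Real.sin ψ) •
      ∫ h : archLocal L 2 (Matrix.of fun i j : Fin 2 => if i.val + j.val + 1 = 2 then (1 : L) else 0) w,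
        f (((h * ⟨Matrix.GeneralLinearGroup.mkOfDetNeZero !![(1 : ℂ), 1; 1, -1] det_cayleyTwo_ne_zero *
              circleDiagonal 2 ![z * Circle.exp ψ, z * Circle.exp (-ψ)] *
              (Matrix.GeneralLinearGroup.mkOfDetNeZero !![(1 : ℂ), 1; 1, -1] det_cayleyTwo_ne_zero)⁻¹,
            cayley_conj_circleDiagonal_mem_archLocal L w _⟩ * h⁻¹ :
          archLocal L 2 (Matrix.of fun i j : Fin 2 => if i.val + j.val + 1 = 2 then (1 : L) else 0) w) : GL (Fin 2) ℂ) : Matrix (Fin 2) (Fin 2) ℂ) ∂ν =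
      (2 * Real.sin ψ) •
        ∫ h' : ↥(unitaryGroupOfForm (starRingEnd ℂ) (Matrix.diagonal ![(2 : ℂ), -2])),
          (fun X : Matrix (Fin 2) (Fin 2) ℂ => f ((!![(1 : ℂ), 1; 1, -1] : Matrix (Fin 2) (Fin 2) ℂ) * X * !![(1 / 2 : ℂ), 1 / 2; 1 / 2, -(1 / 2)]))
          (((h' * ⟨circleDiagonal 2 ![z * Circle.exp ψ, z * Circle.exp (-ψ)], hS' _⟩ * h'⁻¹ :
            ↥(unitaryGroupOfForm (starRingEnd ℂ) (Matrix.diagonal ![(2 : ℂ), -2]))) : GL (Fin 2) ℂ) : Matrix (Fin 2) (Fin 2) ℂ) ∂(ν.map e.symm) := fun ψ => by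
    rw [hγ ψ, integral_comp_conj_transport _ _ e _ he ν f, Matrix.GeneralLinearGroup.val_mkOfDetNeZero, coe_inv_cayleyTwo]
  exact ⟨hGT.congr fun ψ => (key ψ).symm, hLT.congr fun ψ => (key ψ).symm⟩

/-- **THE ORDER-0 JUMP ON `U(Φ₂)_w` IN THE CAYLEY FRAME** (`E = ℂ`, ★ `HasOneSidedJump` currency): for every Haar `ν` ONE `C₁ > 0` such that for every continuous compactly
supported `f : M₂(ℂ) → ℂ` and `z ∈ S¹`, `ψ ↦ 2 sin ψ · ∫_{U(Φ₂)_w} f(h·(P diag(z e^{iψ}, z e^{−iψ}) P⁻¹)·h⁻¹) dν` has both one-sided limits at `ψ = 0` and jumps by `C₁ ·` (the integral of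
`f` over `P·(nilpotent cone at z·1)·P⁻¹`, both nappes) — the `U(Φ₂)_w`-block of the (I₃) order-0 clause of organ (J-H) at a compact place, in the tree's frame.
[cite: Shelstad1979, Lemma 4.3 p. 25] [cite: Varadarajan1989, §6.4 Thm 23] [cite: Rogawski1990, §8.2 pp. 119, 122] -/
theorem exists_hasOneSidedJump_two_sin_mul_orbitalIntegral_cayley
    [MeasurableSpace (archLocal L 2 (Matrix.of fun i j : Fin 2 => if i.val + j.val + 1 = 2 then (1 : L) else 0) w)]
    [BorelSpace (archLocal L 2 (Matrix.of fun i j : Fin 2 => if i.val + j.val + 1 = 2 then (1 : L) else 0) w)]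
    (ν : Measure (archLocal L 2 (Matrix.of fun i j : Fin 2 => if i.val + j.val + 1 = 2 then (1 : L) else 0) w)) [ν.IsHaarMeasure] :
    ∃ C₁ : ℝ, 0 < C₁ ∧
      ∀ (f : Matrix (Fin 2) (Fin 2) ℂ → ℂ), Continuous f → HasCompactSupport f → ∀ z : Circle,
        HasOneSidedJump (fun ψ : ℝ => (2 * Real.sin ψ : ℂ) *
            ∫ h : archLocal L 2 (Matrix.of fun i j : Fin 2 => if i.val + j.val + 1 = 2 then (1 : L) else 0) w,
              f (((h * ⟨Matrix.GeneralLinearGroup.mkOfDetNeZero !![(1 : ℂ), 1; 1, -1] det_cayleyTwo_ne_zero *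
                    circleDiagonal 2 ![z * Circle.exp ψ, z * Circle.exp (-ψ)] *
                    (Matrix.GeneralLinearGroup.mkOfDetNeZero !![(1 : ℂ), 1; 1, -1] det_cayleyTwo_ne_zero)⁻¹,
                  cayley_conj_circleDiagonal_mem_archLocal L w _⟩ * h⁻¹ :
                archLocal L 2 (Matrix.of fun i j : Fin 2 => if i.val + j.val + 1 = 2 then (1 : L) else 0) w) : GL (Fin 2) ℂ) : Matrix (Fin 2) (Fin 2) ℂ) ∂ν)
          ((C₁ : ℂ) * ((∫ p in Ioi (0 : ℝ) ×ˢ Ioc (0 : ℝ) (2 * π),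
              f ((!![(1 : ℂ), 1; 1, -1] : Matrix (Fin 2) (Fin 2) ℂ) *
                ((z : ℂ) • (1 : Matrix (Fin 2) (Fin 2) ℂ) + p.1 • Matrix.diagonal ![(z : ℂ) * I, -((z : ℂ) * I)] +
                  p.1 • !![(0 : ℂ), -((z : ℂ) * I) * cexp (-((p.2 : ℂ) * I)); ((z : ℂ) * I) * cexp ((p.2 : ℂ) * I), 0]) *
                !![(1 / 2 : ℂ), 1 / 2; 1 / 2, -(1 / 2)])) +
            ∫ p in Ioi (0 : ℝ) ×ˢ Ioc (0 : ℝ) (2 * π),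
              f ((!![(1 : ℂ), 1; 1, -1] : Matrix (Fin 2) (Fin 2) ℂ) *
                ((z : ℂ) • (1 : Matrix (Fin 2) (Fin 2) ℂ) + p.1 • Matrix.diagonal ![-((z : ℂ) * I), (z : ℂ) * I] +
                  p.1 • !![(0 : ℂ), ((z : ℂ) * I) * cexp (-((p.2 : ℂ) * I)); -((z : ℂ) * I) * cexp ((p.2 : ℂ) * I), 0]) *
                !![(1 / 2 : ℂ), 1 / 2; 1 / 2, -(1 / 2)]))) := by
  obtain ⟨C₁, hC₁, h⟩ := exists_tendsto_two_sin_smul_orbitalIntegral_cayley_nhdsGT_nhdsLT (E := ℂ) L w ν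
  refine ⟨C₁, hC₁, fun f hf hfc z => ?_⟩
  obtain ⟨hp, hm⟩ := h f hf hfc z
  have hsmul : ∀ (ψ : ℝ) (x : ℂ), (2 * Real.sin ψ) • x = (2 * Real.sin ψ : ℂ) * x := fun ψ x => by
    rw [Complex.real_smul]; push_cast; ring
  refine ⟨_, _, hp.congr fun ψ => hsmul ψ _, hm.congr fun ψ => hsmul ψ _, ?_⟩
  rw [Complex.real_smul, Complex.real_smul]
  ring

end Literature.NumberTheory.Automorphic.UnitaryGroup

end
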